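import Literature.Geometry.Kaehler.CechDeRhamTransgression
import HarnessLib

/-!
# Every `δ`- and `d`-closed Čech cochain of forms TRANSGRESSES: existence of the Čech–de Rham zig-zag

Theorems file of route `MilnorKExponential` of the Hodge summit, crux `SymbolLiftR`
(stmt-HodgeConjecture-18702), line `lefschetz-fold`, kernel `stub_primitiveLiftExists` (LIFT_p for
primitive rational `(p,p)` classes, `2 ≤ p ≤ n/2`).

The symbol clause of the crux asks, for a Čech `(q+1)`-cocycle `σ` of Milnor symbols, for a
closed `(2q+2)`-form `θ` REACHED FROM the symbol forms `w_J = ∧ dlog (σ_J)` by a zig-zag in the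
Čech–de Rham double complex (`Literature.Geometry.Kaehler.IsTransgression hU q w θ`: cochains
`Z_{a,b}` with `δ Z_{q,q+1} = w` on each `U_J`, `cechd Z_{a+1,b} = δ Z_{a,b+1}` down the staircase,
`d Z_{0,2q+1} = θ` on each `U_i`). The tree has the RELATION `IsTransgression` and its linearity,
and separately the exactness of the Čech rows from a partition of unity (Bott–Tu Prop. 8.5,
`cechDeRham_rowExact`, `cechDeRhamRow_exact`), but not the EXISTENCE statement that joins them —
every landed symbol cocycle so far (line bundles, cup products) came with a hand-built zig-zag.
A constructive proof of the kernel (Appell–Humbert cocycles on tori, `Alg ⊆ L`, …) produces NEW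
cocycles and needs existence in general. This file proves it:

* `exists_staircase` — in any anticommuting double complex with exact rows (Weibel's setting of
  the Acyclic Assembly Lemma), a `δ`- and `d`-closed element `c ∈ K^{q+1,q+1}` is the top of a
  staircase `Z` (`δ Z_{q,q+1} = c`, `d Z_{a+1,b} = δ Z_{a,b+1}` for `a + 1 + b = 2q + 1`, `a < q`)
  whose bottom `d Z_{0,2q+1}` is `δ`-closed (pure homological algebra: `q + 1` applications of row
  exactness, the anticommutation `δ d = -d δ` and `d d = 0`);
* `exists_isTransgression` — **on a manifold with a smooth partition of unity subordinate to the
  finite open cover `𝔘`, every Čech `(q+1)`-cochain `w` of forms that is smooth and closed on each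
  `U_J` and `δ`-closed on each `U_{J'}` transgresses to some global form `θ`**
  (`IsTransgression hU q w θ`; `θ` is then smooth and closed, `IsTransgression.mem_closedSmoothForms`).
  Proof: restrict `w` to an honest cochain `c ∈ C^{q+1}(𝔘, Ω^{q+1})`, run `exists_staircase` in
  `cechDeRham I F hU` (rows exact by `cechDeRham_rowExact`), and glue the `δ`-closed bottom
  `d Z_{0,2q+1}` to a global form by the column-`0` exactness `cechDeRhamRow_exact`.

References: R. Bott, L. W. Tu, *Differential Forms in Algebraic Topology* (1982), Prop. 8.5,
Prop. 8.8 (proof: the staircase); C. A. Weibel, *An Introduction to Homological Algebra* (1994),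
1.2.5 and Lemma 2.7.3.
-/

noncomputable section

-- The mandated namespace repeats `HodgeConjecture` (single-conjunct summit).
set_option linter.dupNamespace false

open scoped Manifold Topology ContDiff
open Set Function Filter

namespace Summit.HodgeConjecture.HodgeConjecture.Theorems.SymbolLiftR

open Literature.Algebra.Homology Literature.Geometry.Kaehler

/-! ### The staircase in an abstract double complex with exact rows -/

section Staircase

variable {R : Type*} [CommRing R] {X : ℕ → ℕ → Type*} [∀ p q, AddCommGroup (X p q)]
  [∀ p q, Module R (X p q)]

/-- **The staircase (zig-zag) exists in a double complex with exact rows.** Let `K` be an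
anticommuting double complex whose rows are exact in positive columns, and let `c ∈ K^{q+1,q+1}`
be `δ`-closed and `d`-closed. Then there are `Z_{a,b} ∈ K^{a,b}` with `δ Z_{q,q+1} = c` (top),
`d Z_{a+1,b} = δ Z_{a,b+1}` whenever `a + 1 + b = 2q + 1`, `a < q` (the `q` steps), and
`δ (d Z_{0,2q+1}) = 0` (the bottom is `δ`-closed, ready to be glued). This is the descent of the
proof of Bott–Tu (1982), Prop. 8.8 / Weibel (1994), Lemma 2.7.3: at each step the next
`δ`-equation is solvable because `δ (d Z) = -d (δ Z) = -d (d Z') = 0`. Proof: induction on the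
number of steps, updating one entry of `Z` at a time (`Z + single a (b+1) (y - Z a (b+1))`).
[cite: BottTu1982Forms, §8 Prop. 8.8] -/
theorem exists_staircase (K : ADoubleComplex R X) (hK : K.RowExact) (q : ℕ) (c : X (q + 1) (q + 1))
    (hδ : K.δ (q + 1) (q + 1) c = 0) (hd : K.d (q + 1) (q + 1) c = 0) :
    ∃ Z : (a b : ℕ) → X a b,
      K.δ q (q + 1) (Z q (q + 1)) = c ∧
      (∀ a b : ℕ, a + 1 + b = 2 * q + 1 → a < q →
        K.d (a + 1) b (Z (a + 1) b) = K.δ a (b + 1) (Z a (b + 1))) ∧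
      K.δ 0 (2 * q + 1 + 1) (K.d 0 (2 * q + 1) (Z 0 (2 * q + 1))) = 0 := by
  -- Claim(k): the top, the steps for `a ≥ q - k`, and `δ d Z_{q-k, q+1+k} = 0`.
  have claim : ∀ k : ℕ, k ≤ q → ∃ Z : (a b : ℕ) → X a b,
      K.δ q (q + 1) (Z q (q + 1)) = c ∧
      (∀ a b : ℕ, a + 1 + b = 2 * q + 1 → a < q → q ≤ a + k →
        K.d (a + 1) b (Z (a + 1) b) = K.δ a (b + 1) (Z a (b + 1))) ∧
      (∀ a b : ℕ, a + k = q → a + b = 2 * q + 1 → K.δ a (b + 1) (K.d a b (Z a b)) = 0) := by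
    intro k
    induction k with
    | zero =>
      intro _
      obtain ⟨y, hy⟩ := hK.exact q (q + 1) c hδ
      refine ⟨ADoubleComplex.single q (q + 1) y, ?_, ?_, ?_⟩
      · rw [ADoubleComplex.single_apply_same]
        exact hy
      · intro a b _ hlt hle
        omega
      · intro a b hak hab
        obtain rfl : q = a := by omega
        obtain rfl : q + 1 = b := by omega
        rw [ADoubleComplex.single_apply_same, K.δ_d, hy, hd, neg_zero]
    | succ k ih =>
      intro hk
      obtain ⟨Z, htop, hsteps, hlast⟩ := ih (Nat.le_of_succ_le hk)
      -- the entry to fill: `(a, b₀ + 1)` with `a + (k + 1) = q` and `a + 1 + b₀ = 2q + 1`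
      obtain ⟨a, ha⟩ : ∃ a, a + (k + 1) = q := ⟨q - (k + 1), by omega⟩
      obtain ⟨b₀, hb₀⟩ : ∃ b₀, a + 1 + b₀ = 2 * q + 1 := ⟨2 * q + 1 - (a + 1), by omega⟩
      have hcl : K.δ (a + 1) (b₀ + 1) (K.d (a + 1) b₀ (Z (a + 1) b₀)) = 0 :=
        hlast (a + 1) b₀ (by omega) hb₀
      obtain ⟨y, hy⟩ := hK.exact a (b₀ + 1) _ hcl
      refine ⟨Z + ADoubleComplex.single a (b₀ + 1) (y - Z a (b₀ + 1)), ?_, ?_, ?_⟩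
      · -- the top entry `(q, q+1)` is untouched (`a < q`)
        rw [Pi.add_apply, Pi.add_apply,
          ADoubleComplex.single_apply_of_ne_fst (show q ≠ a by omega), add_zero]
        exact htop
      · intro a' b' hab' hlt hle
        rcases (show q ≤ a' + k ∨ a' = a by omega) with hold | rfl
        · -- an old step: both entries `(a'+1, b')`, `(a', b'+1)` lie in columns `> a`
          rw [Pi.add_apply, Pi.add_apply,
            ADoubleComplex.single_apply_of_ne_fst (show a' + 1 ≠ a by omega), add_zero,
            Pi.add_apply, Pi.add_apply,
            ADoubleComplex.single_apply_of_ne_fst (show a' ≠ a by omega), add_zero]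
          exact hsteps a' b' hab' hlt hold
        · -- the new step in column `a`, `b' = b₀`
          obtain rfl : b' = b₀ := by omega
          rw [Pi.add_apply, Pi.add_apply,
            ADoubleComplex.single_apply_of_ne_fst (show a' + 1 ≠ a' by omega), add_zero,
            Pi.add_apply, Pi.add_apply, ADoubleComplex.single_apply_same, add_sub_cancel, hy]
      · intro a' b' hak hab
        obtain rfl : a' = a := by omega
        obtain rfl : b' = b₀ + 1 := by omega
        rw [Pi.add_apply, Pi.add_apply, ADoubleComplex.single_apply_same, add_sub_cancel, K.δ_d, hy,
          K.d_d, neg_zero]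
  obtain ⟨Z, htop, hsteps, hlast⟩ := claim q le_rfl
  exact ⟨Z, htop, fun a b hab hlt ↦ hsteps a b hab hlt (by omega),
    hlast 0 (2 * q + 1) (by omega) (by omega)⟩

end Staircase

/-! ### Existence of transgressions on a manifold with a partition of unity -/

section Transgression

variable {E : Type*} [NormedAddCommGroup E] [NormedSpace ℝ E]
  {H : Type*} [TopologicalSpace H] {I : ModelWithCorners ℝ E H}
  {M : Type*} [TopologicalSpace M] [ChartedSpace H M]
  {F : Type*} [NormedAddCommGroup F] [NormedSpace ℝ F]
  {ι : Type*} [IsManifold I ∞ M] {U : ι → Set M}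

omit [IsManifold I ∞ M] in
/-- The honest Čech cochain `c_J = w_J|_{U_J} ∈ Ω^k(U_J)` of a family of global forms `w_J`
smooth at the points of `U_J` (restriction = extension by zero off `U_J`). [folklore] -/
theorem restr_mem_smoothFormsOn_cechSet (hU : ∀ i, IsOpen (U i)) {n k : ℕ} {J : Fin n → ι}
    {α : MForm I M F k} (hα : ∀ x ∈ cechSet U J, α.SmoothAt x) :
    α.restr (cechSet U J) ∈ smoothFormsOn I F (cechSet U J) k :=
  ⟨fun x hx ↦ (MForm.smoothAt_restr_iff (isOpen_cechSet hU J) α hx).2 (hα x hx),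
    fun _ hx ↦ MForm.restr_apply_of_notMem α hx⟩

/-- **Every `δ`- and `d`-closed Čech cochain of forms transgresses** (existence of the
Čech–de Rham zig-zag, Bott–Tu (1982), Prop. 8.5 + proof of Prop. 8.8). Let `𝔘 = (U_i)` be a
finite open cover of the manifold `M` carrying a smooth partition of unity subordinate to it, and
let `w = (w_J)_J`, `J` ranging over ordered `(q+2)`-tuples, be global `(q+1)`-forms such that
`w_J` is smooth and closed at the points of `U_J` and `Σ_j (-1)^j w_{J' ∘ δ_j} = 0` at the points
of `U_{J'}` for every `(q+3)`-tuple `J'` (a Čech cocycle of closed forms; only the values of `w_J`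
on `U_J` matter). Then there is a global `(2q+2)`-form `θ` with `IsTransgression hU q w θ` — and any
such `θ` is smooth and closed (`IsTransgression.mem_closedSmoothForms`). [cite: BottTu1982Forms, §8 Prop. 8.8] -/
theorem exists_isTransgression [Fintype ι] (hU : ∀ i, IsOpen (U i))
    (ρ : SmoothPartitionOfUnity ι I M univ) (hρ : ρ.IsSubordinate U) (hcov : ∀ y : M, ∃ i, y ∈ U i)
    (q : ℕ) (w : (Fin (q + 2) → ι) → MForm I M F (q + 1))
    (hws : ∀ J, ∀ x ∈ cechSet U J, (w J).SmoothAt x)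
    (hwd : ∀ J, ∀ x ∈ cechSet U J, mextDeriv (w J) x = 0)
    (hwδ : ∀ J' : Fin (q + 3) → ι, ∀ x ∈ cechSet U J',
      (∑ j : Fin (q + 3), ((-1 : ℝ) ^ (j : ℕ)) • w (J' ∘ Fin.succAbove j)) x = 0) :
    ∃ θ : MForm I M F (2 * q + 1 + 1), IsTransgression hU q w θ := by
  -- the honest cochain `c ∈ C^{q+1}(𝔘, Ω^{q+1})`
  set c : CechForms I F U (q + 1) (q + 1) :=
    fun J ↦ ⟨(w J).restr (cechSet U J), restr_mem_smoothFormsOn_cechSet hU (hws J)⟩ with hc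
  have hcJ : ∀ (J : Fin (q + 2) → ι), ∀ x ∈ cechSet U J, (c J : MForm I M F (q + 1)) x = w J x :=
    fun J x hx ↦ MForm.restr_apply_of_mem _ hx
  -- `δ c = 0`
  have hδ : cechδ I F hU (q + 1) (q + 1) c = 0 := by
    funext J'
    apply Subtype.ext
    funext x
    by_cases hx : x ∈ cechSet U J'
    · rw [coe_cechδ_apply_apply_of_mem hU c hx]
      change _ = (0 : MForm I M F (q + 1)) x
      rw [Pi.zero_apply, ← hwδ J' x hx, Finset.sum_apply]
      refine Finset.sum_congr rfl fun j _ ↦ ?_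
      rw [Pi.smul_apply, hcJ _ x (cechSet_subset_comp U J' (Fin.succAbove j) hx)]
    · rw [(cechδ I F hU (q + 1) (q + 1) c J').2.2 x hx]
      rfl
  -- `d c = 0`
  have hd : cechd I F hU (q + 1) (q + 1) c = 0 := by
    funext J
    apply Subtype.ext
    rw [cechd_apply, Submodule.coe_smul]
    change _ = (0 : MForm I M F (q + 1 + 1))
    refine (smul_eq_zero_of_right _ ?_)
    funext x
    by_cases hx : x ∈ cechSet U J
    · rw [localD_apply_of_mem _ _ hx, Pi.zero_apply]
      change mextDeriv ((w J).restr (cechSet U J)) x = 0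
      rw [mextDeriv_restr_apply (isOpen_cechSet hU J) _ hx, hwd J x hx]
    · rw [(localD I F (q + 1) (isOpen_cechSet hU J) (c J)).2.2 x hx, Pi.zero_apply]
  -- the staircase in `cechDeRham I F hU`
  obtain ⟨Z, htop, hsteps, hlast⟩ :=
    exists_staircase (cechDeRham I F hU) (cechDeRham_rowExact hU ρ hρ) q c hδ hd
  -- glue the `δ`-closed bottom to a global form
  obtain ⟨θ, hθ⟩ := (cechDeRhamRow_exact hU ρ hρ hcov).exact (2 * q + 1 + 1) _ hlast
  refine ⟨(θ : MForm I M F (2 * q + 1 + 1)), Z, fun J x hx ↦ ?_, hsteps, fun J x hx ↦ ?_⟩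
  · -- top: `δ Z_{q,q+1} = c = w` on `U_J`
    have h := congrArg (fun f : CechForms I F U (q + 1) (q + 1) ↦ (f J : MForm I M F (q + 1)) x) htop
    rw [← hcJ J x hx]
    exact h
  · -- bottom: `d Z_{0,2q+1} = r θ = θ` on `U_i`
    have h := congrArg (fun f : CechForms I F U 0 (2 * q + 1 + 1) ↦
      (f J : MForm I M F (2 * q + 1 + 1)) x) hθ
    simp only [coe_cechDeRhamRow_ε] at h
    rw [MForm.restr_apply_of_mem _ hx] at h
    exact h.symm

end Transgression

/-- STUB `stub_exists_isTransgression` (helper sub-goal registered on stmt-HodgeConjecture-18702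
for the kernel `stub_primitiveLiftExists`: the Čech–de Rham zig-zag EXISTS for every smooth,
closed, `δ`-closed cochain of forms on a finite cover with a subordinate partition of unity — the
analytic half of every `HasSymbolCocycle` a constructive proof of the kernel must exhibit):
`exists_isTransgression`, stated closed. [cite: BottTu1982Forms, §8 Prop. 8.8] -/
theorem stub_exists_isTransgression : ∀ {E : Type*} [NormedAddCommGroup E] [NormedSpace ℝ E] {H : Type*} [TopologicalSpace H] {I : ModelWithCorners ℝ E H} {M : Type*} [TopologicalSpace M] [ChartedSpace H M] {F : Type*} [NormedAddCommGroup F] [NormedSpace ℝ F] {ι : Type*} [IsManifold I ∞ M] {U : ι → Set M} [Fintype ι] (hU : ∀ i, IsOpen (U i)) (ρ : SmoothPartitionOfUnity ι I M Set.univ), ρ.IsSubordinate U → (∀ y : M, ∃ i, y ∈ U i) → ∀ (q : ℕ) (w : (Fin (q + 2) → ι) → MForm I M F (q + 1)), (∀ J, ∀ x ∈ cechSet U J, (w J).SmoothAt x) → (∀ J, ∀ x ∈ cechSet U J, mextDeriv (w J) x = 0) → (∀ J' : Fin (q + 3) → ι, ∀ x ∈ cechSet U J', (∑ j : Fin (q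 + 3), ((-1 : ℝ) ^ (j : ℕ)) • w (J' ∘ Fin.succAbove j)) x = 0) → ∃ θ : MForm I M F (2 * q + 1 + 1), IsTransgression hU q w θ :=
  fun hU ρ hρ hcov q w hws hwd hwδ ↦ exists_isTransgression hU ρ hρ hcov q w hws hwd hwδ

end Summit.HodgeConjecture.HodgeConjecture.Theorems.SymbolLiftR

end
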